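import Summits.BirchSwinnertonDyer.Rank1Residual.X11b.RegMultShaAnCertificate
import HarnessLib

/-!
# Class X11b = N8 (census cell, seat `census-ctyper-2`, H-7 REG-MULT / SHAAN): `p`-SATURATION —
# when the certified height VALUE of a REGMULT / S-PADIC row has the valuation of `Reg_p`

HONEST FRAMING (verbatim, cell `b2b-bsdres`, run/shared/lean/b2b/bsd-rank1-residual/): the goal of
the cell is to DELETE the COMBINATION-SHAPED residual classes for ALL analytic-rank `≤ 1` curves
over `ℚ` — 'full BSD formula for every rank `≤ 1` curve in class C' assembled STRICTLY from
published theorems — so that the rank-`≤ 1` remainder becomes exactly the CONSTRUCTION-SHAPED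
classes, which are TYPED (missing-input Props), NOT attempted; this is not 'finishing BSD'.
Research routes; no claim beyond stated classes; census / instrument output = EVIDENCE /
certificate rows (instrumentation tier — what a certified row is worth is referee A's / the
director's ruling), never a Literature fact; nothing here books anything or changes a label or a
RESIDUAL-MAP mark; class X11b stays CONSTRUCTION-SHAPED.

Sequel of `X11b/RegMultShaAnCertificate.lean` (p255944), §3 of its plan, split off for the 400-line
limit; census-lead G-13 SHAAN5 addition ASH-4 ('an unsaturated generator divides `#Ш_an` by `k²`,
exactly the failure the certificate exists to exclude') made a KERNEL hypothesis: the S-PADIC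
closures of p255944 take `hb : v(Reg_p(E, Dh)) = b`, whereas a row computes `⟨P, P⟩_{Dh}` for ONE
point `P`; the theorems below take instead `hb : v(⟨P', P'⟩_{Dh}) = b` together with the
`p`-saturation of `P'` (`hsat : ∀ Q, ¬ IsOfFinAddOrder (P' - p • Q)`, the content of the schema's
`sat_p` witness) and prove `v(Reg_p(E, Dh)) = v(⟨P', P'⟩_{Dh})` in rank one. THEOREMS ONLY (0
definitions, 0 named facts). References: [MazurTateTeitelbaum1986Invent] §II.4 (the `p`-adic
regulator on `E(ℚ)/tors`); [SilvermanAEC2009] VIII.6 (Mordell–Weil basis); the citations of the two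
closures are those of p255944 §2.
-/

set_option autoImplicit false

noncomputable section

open scoped Classical MatrixGroups ModularForm

open CongruenceSubgroup WeierstrassCurve
open Literature.NumberTheory.EllipticCurves
  Literature.NumberTheory.EllipticCurves.ModularForms
  Literature.NumberTheory.EllipticCurves.Rank1Residual
  Literature.NumberTheory.EllipticCurves.Rank1Residual.Typed
  Literature.NumberTheory.EllipticCurves.Wuthrich2014
  Literature.NumberTheory.EllipticCurves.SteinWuthrich2013
  Literature.NumberTheory.EllipticCurves.Disegni2020
  Literature.NumberTheory.EllipticCurves.Skinner2016

namespace Summit.BirchSwinnertonDyer.Rank1Residual.X11b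

namespace RegMult

/-! ### `p`-saturation versus the regulator (§3 of the plan of `RegMultShaAnCertificate`)

A REGMULT / S-PADIC row computes `h_p(P) = ⟨P, P⟩_{Dh}` for ONE rational point `P` (Cremona's
generator), while the identity of p255944 §2 involves `Reg_p(E, Dh) = ⟨g, g⟩` for a Mordell–Weil basis
element `g`; in rank one `P = k • g + t` (`t` torsion), `⟨P, P⟩ = k²·Reg_p`, so
`v(⟨P, P⟩) = v(Reg_p) + 2·ord_p k` and the two agree iff `p ∤ k`, i.e. iff `P ∉ p·E(ℚ) + E(ℚ)_tors`
("`P` is `p`-saturated" — a finite exact check: reduce at a good prime `ℓ` with cyclic `p`-Sylow of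
`E(𝔽_ℓ)` and test `(#E(𝔽_ℓ)/p)·P̃ ≠ O`, schema `SHAAN-CERT-SCHEMA.md` §3 `sat_p`). An UNsaturated `P`
would make `#Ш_an` look LESS divisible by `p` (unsound for `hv`); the theorems below carry the
saturation hypothesis `hsat` explicitly and replace `hb : v(Reg_p(Dh)) = b` of p255944 §2 by
`hb : v(⟨P, P⟩_{Dh}) = b` for a `p`-saturated `P`. The Mordell–Weil basis lives in the quotient
`E(ℚ)/E(ℚ)_tors` of `MordellWeil.lean`, whose group law on `E(ℚ)` is elaborated with the classical
`DecidableEq ℚ`; the first lemma is proved over a general field (so in that world) and transported (`convert`, the two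
`AddCommGroup` structures differ by a `Subsingleton` instance argument — cf.
`PAdicHeightNondegeneracyProofs`). -/

section SaturationClassical

variable {K : Type*} [Field K] {W : WeierstrassCurve K}

/-- **Rank one: every point is an integer multiple of the Mordell–Weil basis element up to
torsion** — over any field `K`, for a one-element Mordell–Weil basis `g` (index type `ι` with a
`Unique` instance) and any `P ∈ E(K)` there is `k ∈ ℤ` with `P - k • g` of finite order (the image
of `P` in `E(K)/tors = ℤ·ḡ`). Stated over a general field, hence for the group law with the
classical `DecidableEq K` of `MordellWeil.lean` (at `K = ℚ` it is transported by `convert`).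
[folklore] [cite: SilvermanAEC2009, VIII.6] -/
theorem exists_isOfFinAddOrder_sub_zsmul_of_isMordellWeilBasis {ι : Type*} [Unique ι]
    {g : ι → W.toAffine.Point} (hg : IsMordellWeilBasis g) (P : W.toAffine.Point) :
    ∃ k : ℤ, IsOfFinAddOrder (P - k • g default) := by
  have hmem : (QuotientAddGroup.mk P : mordellWeilModTorsion W) ∈
      Submodule.span ℤ (Set.range (QuotientAddGroup.mk ∘ g : ι → mordellWeilModTorsion W)) := by
    rw [hg.2]; exact Submodule.mem_top
  have hrange : Set.range (QuotientAddGroup.mk ∘ g : ι → mordellWeilModTorsion W) =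
      {(QuotientAddGroup.mk (g default) : mordellWeilModTorsion W)} := by
    ext x
    simp only [Set.mem_range, Function.comp_apply, Set.mem_singleton_iff]
    constructor
    · rintro ⟨i, rfl⟩; rw [Unique.eq_default i]
    · rintro rfl; exact ⟨default, rfl⟩
  rw [hrange, Submodule.mem_span_singleton] at hmem
  obtain ⟨k, hk⟩ := hmem
  refine ⟨k, (AddCommGroup.mem_torsion _).mp ?_⟩
  rw [← QuotientAddGroup.eq_zero_iff, QuotientAddGroup.mk_sub, QuotientAddGroup.mk_zsmul, ← hk, sub_self]

end SaturationClassical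

section Saturation

variable (W : WeierstrassCurve ℚ) [W.IsElliptic] (p : ℕ) [Fact p.Prime]

omit [W.IsElliptic] in
/-- **`⟨P, P⟩_D = k²·⟨Q, Q⟩_D` when `P - k • Q` is torsion** (bilinearity, symmetry, and the
vanishing of `D` on torsion in each variable). [folklore] [cite: MazurTateTeitelbaum1986Invent, §II.4] -/
theorem pairing_self_eq_of_isOfFinAddOrder_sub_zsmul {W : WeierstrassCurve ℚ} {p : ℕ} [Fact p.Prime]
    (D : PAdicHeightData W p) (P Q : W.toAffine.Point) (k : ℤ) (ht : IsOfFinAddOrder (P - k • Q)) :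
    D.pairing P P = ((k : ℚ_[p]) * k) * D.pairing Q Q := by
  set t := P - k • Q with htdef
  have hP : P = k • Q + t := by rw [htdef]; abel
  have h1 : D.pairing (k • Q + t) (k • Q + t) = D.pairing (k • Q) (k • Q) := by
    rw [map_add (D.pairing (k • Q + t)), D.map_torsion_right _ t ht, add_zero,
      map_add D.pairing, AddMonoidHom.add_apply, D.map_torsion t _ ht, add_zero]
  rw [hP, h1, map_zsmul (D.pairing (k • Q)), D.symm (k • Q) Q, map_zsmul (D.pairing Q), smul_smul,
    zsmul_eq_mul, Int.cast_mul]

variable {W p} in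
/-- **`p`-saturation ⇒ the certified height value has the valuation of the regulator.** If
`rank E(ℚ) = 1`, `⟨P, P⟩_D ≠ 0` and `P ∉ p·E(ℚ) + E(ℚ)_tors` (`hsat`: no `Q` with `P - p • Q` of
finite order), then `v(Reg_p(E, D)) = v(⟨P, P⟩_D)`: with `g` the Mordell–Weil basis element
(`exists_isMordellWeilBasis_holds`, `IsMordellWeilBasis.card_eq` via `hr`), `Reg_p(E, D) = ⟨g, g⟩`
(`padicRegulatorOf_eq_padicRegulator_holds`, `padicRegulatorOf_eq_of_subsingleton`), `P = k • g + t`,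
`⟨P, P⟩ = k²⟨g, g⟩` and `p ∤ k` (else `P - p • ((k/p) • g)` is torsion), so `v(k²) = 0`.
[folklore] [cite: MazurTateTeitelbaum1986Invent, §II.4] -/
theorem valuation_padicRegulator_eq_of_saturated (D : PAdicHeightData W p)
    (hr : W.mordellWeilRank = 1) {P : W.toAffine.Point} (hP0 : D.pairing P P ≠ 0)
    (hsat : ∀ Q : W.toAffine.Point, ¬ IsOfFinAddOrder (P - (p : ℤ) • Q)) :
    (padicRegulator D).valuation = (D.pairing P P).valuation := by
  obtain ⟨g₀, hg₀⟩ := W.exists_isMordellWeilBasis_holds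
  have e : Fin W.mordellWeilRank ≃ Fin 1 := finCongr hr
  have hg : IsMordellWeilBasis (g₀ ∘ e.symm) := hg₀.reindex e
  have hReg : padicRegulator D = D.pairing ((g₀ ∘ e.symm) default) ((g₀ ∘ e.symm) default) := by
    rw [← hg.padicRegulatorOf_eq_padicRegulator D, D.padicRegulatorOf_eq_of_subsingleton _ default]
  obtain ⟨k, hk⟩ := exists_isOfFinAddOrder_sub_zsmul_of_isMordellWeilBasis hg P
  have hkt : IsOfFinAddOrder (P - k • (g₀ ∘ e.symm) default) := by
    convert hk
  have hPP := pairing_self_eq_of_isOfFinAddOrder_sub_zsmul D P ((g₀ ∘ e.symm) default) k hkt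
  have hpk : ¬ (p : ℤ) ∣ k := by
    rintro ⟨j, hj⟩
    apply hsat (j • (g₀ ∘ e.symm) default)
    rwa [smul_smul, ← hj]
  have hk0 : (k : ℚ_[p]) ≠ 0 := by
    have : k ≠ 0 := by rintro rfl; exact hpk (dvd_zero _)
    exact_mod_cast this
  have hgg : D.pairing ((g₀ ∘ e.symm) default) ((g₀ ∘ e.symm) default) ≠ 0 := by
    intro h0; rw [h0, mul_zero] at hPP; exact hP0 hPP
  have hvk : (k : ℚ_[p]).valuation = 0 := by
    rw [Padic.valuation_intCast, padicValInt.eq_zero_of_not_dvd hpk, Nat.cast_zero]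
  rw [hReg, hPP, Padic.valuation_mul (mul_ne_zero hk0 hk0) hgg, Padic.valuation_mul hk0 hk0, hvk]
  ring

variable {W p} in
omit [W.IsElliptic] [Fact p.Prime] in
/-- **A `p`-saturated point has infinite order** (take `Q = 0` in `hsat`). [folklore] -/
theorem not_isOfFinAddOrder_of_saturated {P : W.toAffine.Point}
    (hsat : ∀ Q : W.toAffine.Point, ¬ IsOfFinAddOrder (P - (p : ℤ) • Q)) : ¬ IsOfFinAddOrder P := by
  simpa using hsat 0

variable [W.IsGloballyMinimal]

/-- **Per-pair closure, NON-SPLIT `¬Ram` cell, from ONE REGMULT row + an S-PADIC row, with the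
regulator valuation read off the row's OWN point** (`hb : v(⟨P', P'⟩_{Dh}) = b` for a `p`-SATURATED
`P'`, `hsat`) instead of `v(Reg_p(Dh))`: as `bsdp_of_katoSurj_of_certNonsplit_of_leadingCoeffVal`
(§2), the row's Schneider half giving `⟨P', P'⟩ ≠ 0` for the non-torsion `P'`
(`schneider_iff_forall_pairing_self_ne_zero`) and §3 giving `v(Reg_p(Dh)) = b`. This is the exact
shape of a SHAAN-PADIC/v1 row with its `sat_p` witness (schema §3). CONDITIONAL on the named facts
incl. Disegni 2020 Thm. 4 •1 (A185); per pair; nothing booked; X11b stays CONSTRUCTION-SHAPED.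
[cite: Wuthrich2014, Thm. 3 (p. 383)] [cite: SteinWuthrich2013, Thm. 6.1 (p. 20), §4.2 (p. 15)]
[cite: Disegni2020, Thm. 1 (§1.2); Thm. 4 (first bullet)] [cite: Miller2011LMS, Def. 1.1, Prop. 7.6] -/
theorem bsdp_of_katoSurj_of_certNonsplit_of_leadingCoeffVal_of_saturated
    (hK : kato_charIdeal_dvd_multiplicative_of_surjective) (hJn : thm61_nonsplitMultiplicative)
    (hHn : exists_isMultCanonical) (hD : thm1_padicBSD_rankOne_multiplicative)
    (hA : Disegni2020.padicBSD_nonsplitMult_rankOne)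
    (hGZK : rank_eq_analyticRank_of_analyticRank_le_one) (hpar : nonempty_modularParametrizationData)
    (hp5 : 5 ≤ p) (hX : ClassX11b W p) (hsurj : Surj W p)
    (hns : ¬ W.HasSplitMultiplicativeReductionAtPrime p)
    {P : W.toAffine.Point} {m : ℕ} (hc : CertNonsplit W p P m)
    {q : ℚ_[p]} (hq0 : q ≠ 0) (hq1 : ‖q‖ < 1) (hqj : tateJ q = (W.j : ℚ_[p]))
    {N : ℕ} [NeZero N] {f : CuspForm (Gamma0 N) 2} (hf : IsNewformOf W f)
    {L : PowerSeries ℚ_[p]} (hL : IsMultPAdicLFunctionOf f p (-1) L)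
    {Dh : PAdicHeightData W p} (hDh : IsMultCanonical Dh q)
    {ϖ : ℚ} (hϖ : (ϖ : ℝ) * W.realPeriodRat = plusPeriod f) {s : ℚ} (hs : shaAn W = (s : ℂ))
    {P' : W.toAffine.Point} (hsat : ∀ Q : W.toAffine.Point, ¬ IsOfFinAddOrder (P' - (p : ℤ) • Q))
    {a b : ℤ}
    (ha : ((ϖ : ℚ_[p]) * PowerSeries.coeff 1 L * padicLog p (cyclotomicGenerator p)).valuation = a)
    (hb : (Dh.pairing P' P').valuation = b)
    (hle : a + 2 * (padicValNat p W.torsionOrder : ℤ) ≤ b + (padicValNat p W.tamagawaProduct : ℤ)) :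
    BSDp W p := by
  have hr := mordellWeilRank_eq_one_of_analyticRank hGZK hX.1
  have hReg : padicRegulator Dh ≠ 0 := schneiderHalf_nonsplit_of_cert hr hc q Dh hq0 hq1 hqj hDh
  have hP0 : Dh.pairing P' P' ≠ 0 :=
    (schneider_iff_forall_pairing_self_ne_zero Dh hr).mp hReg P' (not_isOfFinAddOrder_of_saturated hsat)
  exact bsdp_of_katoSurj_of_certNonsplit_of_leadingCoeffVal W p hK hJn hHn hD hA hGZK hpar hp5 hX hsurj
    hns hc hq0 hq1 hqj hf hL hDh hϖ hs ha
    ((valuation_padicRegulator_eq_of_saturated Dh hr hP0 hsat).trans hb) hle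

/-- **Per-pair closure, SPLIT `¬Ram` cell (second multiplicative prime), from ONE REGMULT row + an
S-PADIC row with the regulator valuation read off a `p`-saturated point** — the split twin of
`bsdp_of_katoSurj_of_certNonsplit_of_leadingCoeffVal_of_saturated` (A186, `Dq`, `hl`).
CONDITIONAL; per pair; nothing booked. [cite: Wuthrich2014, Thm. 3 (p. 383)]
[cite: SteinWuthrich2013, Thm. 6.1 (p. 20), §4.2 (p. 16)]
[cite: Disegni2020, Thm. 1 (§1.2), (∗); Thm. 4 (second bullet)] [cite: Miller2011LMS, Def. 1.1] -/
theorem bsdp_of_katoSurj_of_certSplit_of_leadingCoeffVal_of_saturated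
    (hK : kato_charIdeal_dvd_multiplicative_of_surjective) (hJs : thm61_splitMultiplicative)
    (hHs : exists_isSplitMultCanonical) (hD : thm1_padicBSD_rankOne_multiplicative)
    (hA2 : Disegni2020.padicBSD_splitMult_rankOne)
    (hGZK : rank_eq_analyticRank_of_analyticRank_le_one) (hpar : nonempty_modularParametrizationData)
    (hp5 : 5 ≤ p) (hX : ClassX11b W p) (hsurj : Surj W p)
    (hm : ∃ (m : ℕ) (_ : Fact m.Prime), m ≠ p ∧ W.HasMultiplicativeReductionAtPrime m)
    {P : W.toAffine.Point} {m : ℕ} (hc : CertSplit W p P m)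
    (Dq : TateParameterData W p)
    {N : ℕ} [NeZero N] {f : CuspForm (Gamma0 N) 2} (hf : IsNewformOf W f)
    {L : PowerSeries ℚ_[p]} (hL : IsSplitMultPAdicLFunctionOf f p L)
    {Dh : PAdicHeightData W p} (hDh : IsSplitMultCanonical Dh Dq)
    {ϖ : ℚ} (hϖ : (ϖ : ℝ) * W.realPeriodRat = plusPeriod f) {s : ℚ} (hs : shaAn W = (s : ℂ))
    {P' : W.toAffine.Point} (hsat : ∀ Q : W.toAffine.Point, ¬ IsOfFinAddOrder (P' - (p : ℤ) • Q))
    {a l b : ℤ}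
    (ha : ((ϖ : ℚ_[p]) * PowerSeries.coeff 2 L * padicLog p (cyclotomicGenerator p) ^ 2).valuation = a)
    (hl : (LInvariant Dq).valuation = l) (hb : (Dh.pairing P' P').valuation = b)
    (hle : a + 2 * (padicValNat p W.torsionOrder : ℤ) ≤
      l + b + (padicValNat p W.tamagawaProduct : ℤ)) :
    BSDp W p := by
  have hr := mordellWeilRank_eq_one_of_analyticRank hGZK hX.1
  have hReg : padicRegulator Dh ≠ 0 := schneiderHalf_split_of_cert hr hc Dq Dh hDh
  have hP0 : Dh.pairing P' P' ≠ 0 :=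
    (schneider_iff_forall_pairing_self_ne_zero Dh hr).mp hReg P' (not_isOfFinAddOrder_of_saturated hsat)
  exact bsdp_of_katoSurj_of_certSplit_of_leadingCoeffVal W p hK hJs hHs hD hA2 hGZK hpar hp5 hX hsurj hm
    hc Dq hf hL hDh hϖ hs ha hl ((valuation_padicRegulator_eq_of_saturated Dh hr hP0 hsat).trans hb) hle

end Saturation

end RegMult

end Summit.BirchSwinnertonDyer.Rank1Residual.X11b

end
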